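import Mathlib
import HarnessLib

/-!
# The symplectic Lie algebra `𝔰𝔭(2l, K)` is simple (`char K ≠ 2`)

`LieAlgebra.Symplectic.sp l K` is Mathlib's symplectic Lie algebra: the `(l ⊕ l) × (l ⊕ l)` matrices `X` over `K`
that are skew-adjoint for the standard alternating form `J = (0 −1; 1 0)` (`Matrix.J l K`), i.e. `XᵀJ = −JX`.
Humphreys [Humphreys1972, §1.2, type `C_l`] uses `s = (0 1; −1 0) = −J`, which gives the same algebra, and
describes it in block form: `X = (m n; p q)` lies in `𝔰𝔭(2l, K)` iff `nᵀ = n`, `pᵀ = p`, `q = −mᵀ`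
(`fromBlocks_mem_sp_iff`), with the standard basis (primes denote the second copy of `l`, `E_{pq}` the matrix
units of size `2l`)

* `m(E_{ab}) = E_{ab} − E_{b'a'}` (in particular the diagonal `h_a = E_{aa} − E_{a'a'}`),
* `n(E_{aa}) = E_{aa'}`, `n(E_{ab} + E_{ba}) = E_{ab'} + E_{ba'}` (`a ≠ b`),
* `p(E_{aa}) = E_{a'a}`, `p(E_{ab} + E_{ba}) = E_{a'b} + E_{b'a}` (`a ≠ b`),

so that `dim 𝔰𝔭(2l, K) = 2l² + l`.

## Main results

* `eq_bot_or_eq_top_of_lieIdeal`: if `2 ≠ 0` in `K`, every Lie ideal of `𝔰𝔭(2l, K)` is `⊥` or `⊤`.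
* `sp_non_abelian`: `𝔰𝔭(2l, K)` is not abelian (`l` non-empty).
* `isSimple_sp`, `isSimple_sp_of_charZero`: **`𝔰𝔭(2l, K)` is a simple Lie algebra** for `l` non-empty and
  `char K ≠ 2` [Humphreys1972, §19.2 (type `C_l`)], [Hall2015, Cor. 8.47 (`𝔰𝔭(n; ℂ)`, `n ≥ 1`)].

## Proof

We follow the matrix-unit argument of [Humphreys1972, §2 Exercise 6, §19.2] exactly as in
`Literature/Algebra/Lie/SpecialLinearSimple.lean`, run on the image `P ⊆ M_{2l}(K)` of an ideal `I`, a
`K`-submodule stable under `m ↦ Ym − mY` for `Y ∈ 𝔰𝔭(2l, K)`.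
*Step 1.* A non-zero `X ∈ P` yields some `E_{kk'} ∈ P`: if the lower-left block `p` of `X` has a non-zero entry
`X_{i'j}`, then `[E_{jj'}, [E_{ii'}, X]] = −X_{i'j}(E_{ij'} + E_{ji'})` (`nn_comm`), and bracketing once more with
`m(E_{ji})` gives `2E_{jj'}` (`m_comm_nsum`); a non-zero entry in the block `m` (or `q = −mᵀ`) is moved to the block
`p` by `[E_{j'j}, ·]`, and a non-zero entry of `n` is moved to the block `m` by `[E_{k'k}, ·]`.
*Step 2.* From one `E_{kk'}` the brackets with basis elements produce all `E_{aa'}`, `E_{a'a}`, `h_a`,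
`E_{ab'} + E_{ba'}`, `E_{a'b} + E_{b'a}` and `m(E_{ab})` (this uses `2 ≠ 0` twice).
*Step 3.* These span `𝔰𝔭(2l, K)`: for `X = (m n; p −mᵀ)` one has `2n = n + nᵀ = Σ n_{ab}(E_{ab} + E_{ba})`, and
similarly for `p`.
No Killing form, root system or Cartan criterion is needed, so the result holds in every characteristic `≠ 2`.

## References

* [Humphreys1972] J. E. Humphreys, *Introduction to Lie Algebras and Representation Theory*, GTM 9, Springer 1972,
  §1.2 (the classical algebras, type `C_l`, p. 3), §2 Exercise 6, §19.2 (the classical algebras are simple, p. 102).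
* [Hall2015] B. C. Hall, *Lie Groups, Lie Algebras, and Representations*, 2nd ed., GTM 222, Springer 2015,
  Corollary 8.47.
-/

namespace Literature.Algebra.Lie.SymplecticSimple

open LieAlgebra LieAlgebra.Symplectic Matrix Sum

variable {l : Type*} [Fintype l] [DecidableEq l] {R : Type*} [CommRing R] {K : Type*} [Field K]

/-! ### Matrix units -/

/-- Matrix units: `E_{pq}E_{rs} = 0` for `q ≠ r`. [folklore] [cite: Humphreys1972, §1.2] -/
private theorem E_mul_E_of_ne {ι : Type*} [Fintype ι] [DecidableEq ι] {p q r s : ι} (h : q ≠ r) :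
    single p q (1 : R) * single r s (1 : R) = 0 :=
  single_mul_single_of_ne _ _ _ _ h _

/-- Matrix units: `E_{pq}E_{qs} = E_{ps}`. [folklore] [cite: Humphreys1972, §1.2] -/
private theorem E_mul_E {ι : Type*} [Fintype ι] [DecidableEq ι] (p q s : ι) :
    single p q (1 : R) * single q s (1 : R) = single p s 1 := by
  rw [single_mul_single_same, mul_one]

/-- Matrix units: `E_{pq}XE_{rs} = X_{qr}E_{ps}`. [folklore] [cite: Humphreys1972, §1.2] -/
private theorem E_mul_mul_E {ι : Type*} [Fintype ι] [DecidableEq ι] (p q r s : ι) (X : Matrix ι ι R) :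
    single p q (1 : R) * X * single r s (1 : R) = single p s (X q r) := by
  rw [single_mul_mul_single, one_mul, mul_one]

/-- Matrix units of size `2l`: `E_{p a'}E_{b s} = 0` (`a' ≠ b`). [folklore] [cite: Humphreys1972, §1.2] -/
private theorem E_inr_mul_E_inl (p s : l ⊕ l) (a b : l) :
    single p (inr a) (1 : R) * single (inl b) s (1 : R) = 0 :=
  E_mul_E_of_ne inr_ne_inl

/-- `cE_{pq} = c • E_{pq}`. [folklore] -/
private theorem single_eq_smul_E {ι : Type*} [DecidableEq ι] (p q : ι) (c : R) :
    single p q c = c • single p q (1 : R) := by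
  rw [smul_single, smul_eq_mul, mul_one]

/-! ### Membership in `𝔰𝔭(2l, R)`: block form and the standard basis [Humphreys1972, §1.2] -/

/-- `X ∈ 𝔰𝔭(2l, R) ↔ XᵀJ = −JX` (`J = (0 −1; 1 0)`). [cite: Humphreys1972, §1.2 (type `C_l`: `sx = −xᵗs`)] -/
theorem mem_sp_iff_transpose_mul_J (X : Matrix (l ⊕ l) (l ⊕ l) R) :
    X ∈ sp l R ↔ Xᵀ * Matrix.J l R = -(Matrix.J l R * X) := by
  rw [LieAlgebra.Symplectic.sp, mem_skewAdjointMatricesLieSubalgebra, mem_skewAdjointMatricesSubmodule,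
    Matrix.IsSkewAdjoint, Matrix.IsAdjointPair, Matrix.mul_neg]

/-- **Block form of `𝔰𝔭(2l, R)`** (Humphreys' `x = (m n; p q)` is symplectic iff `nᵗ = n`, `pᵗ = p`, `mᵗ = −q`):
`(A B; C D) ∈ 𝔰𝔭(2l, R) ↔ D = −Aᵀ ∧ Bᵀ = B ∧ Cᵀ = C`. [cite: Humphreys1972, §1.2 (type `C_l`)] -/
theorem fromBlocks_mem_sp_iff (A B C D : Matrix l l R) :
    fromBlocks A B C D ∈ sp l R ↔ D = -Aᵀ ∧ Bᵀ = B ∧ Cᵀ = C := by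
  rw [mem_sp_iff_transpose_mul_J, Matrix.J, fromBlocks_transpose, fromBlocks_multiply, fromBlocks_multiply,
    fromBlocks_neg, fromBlocks_inj]
  simp only [Matrix.mul_zero, Matrix.mul_one, Matrix.mul_neg, zero_add, add_zero, Matrix.zero_mul, Matrix.one_mul,
    Matrix.neg_mul, neg_neg]
  constructor
  · rintro ⟨hC, hA, -, hB⟩
    exact ⟨hA.symm, neg_inj.mp hB, hC⟩
  · rintro ⟨hD, hB, hC⟩
    refine ⟨hC, hD.symm, ?_, by rw [hB]⟩
    rw [hD, transpose_neg, transpose_transpose]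

/-- The lower-right block of `X ∈ 𝔰𝔭(2l, R)` is minus the transpose of the upper-left one: `X_{a'b'} = −X_{ba}`.
[cite: Humphreys1972, §1.2 (type `C_l`, `mᵗ = −q`)] -/
theorem apply_inr_inr_of_mem_sp {X : Matrix (l ⊕ l) (l ⊕ l) R} (hX : X ∈ sp l R) (a b : l) :
    X (inr a) (inr b) = -X (inl b) (inl a) := by
  rw [← fromBlocks_toBlocks X, fromBlocks_mem_sp_iff] at hX
  have h := congrFun (congrFun hX.1 a) b
  simpa [toBlocks₂₂, toBlocks₁₁] using h

/-- The upper-right block of `X ∈ 𝔰𝔭(2l, R)` is symmetric: `X_{ab'} = X_{ba'}`.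
[cite: Humphreys1972, §1.2 (type `C_l`, `nᵗ = n`)] -/
theorem apply_inl_inr_of_mem_sp {X : Matrix (l ⊕ l) (l ⊕ l) R} (hX : X ∈ sp l R) (a b : l) :
    X (inl a) (inr b) = X (inl b) (inr a) := by
  rw [← fromBlocks_toBlocks X, fromBlocks_mem_sp_iff] at hX
  have h := congrFun (congrFun hX.2.1 a) b
  simpa [toBlocks₁₂] using h.symm

/-- The lower-left block of `X ∈ 𝔰𝔭(2l, R)` is symmetric: `X_{a'b} = X_{b'a}`.
[cite: Humphreys1972, §1.2 (type `C_l`, `pᵗ = p`)] -/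
theorem apply_inr_inl_of_mem_sp {X : Matrix (l ⊕ l) (l ⊕ l) R} (hX : X ∈ sp l R) (a b : l) :
    X (inr a) (inl b) = X (inr b) (inl a) := by
  rw [← fromBlocks_toBlocks X, fromBlocks_mem_sp_iff] at hX
  have h := congrFun (congrFun hX.2.2 a) b
  simpa [toBlocks₂₁] using h.symm

omit [Fintype l] in
/-- `E_{ab}` (size `2l`) is the block matrix `(E_{ab} 0; 0 0)`. [cite: Humphreys1972, §1.2] -/
theorem single_inl_inl (a b : l) (c : R) :
    (single (inl a) (inl b) c : Matrix (l ⊕ l) (l ⊕ l) R) = fromBlocks (single a b c) 0 0 (0 : Matrix l l R) := by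
  ext p q
  rcases p with p | p <;> rcases q with q | q <;> simp [single_apply]

omit [Fintype l] in
/-- `E_{ab'}` is the block matrix `(0 E_{ab}; 0 0)`. [cite: Humphreys1972, §1.2] -/
theorem single_inl_inr (a b : l) (c : R) :
    (single (inl a) (inr b) c : Matrix (l ⊕ l) (l ⊕ l) R) = fromBlocks 0 (single a b c) 0 (0 : Matrix l l R) := by
  ext p q
  rcases p with p | p <;> rcases q with q | q <;> simp [single_apply]

omit [Fintype l] in
/-- `E_{a'b}` is the block matrix `(0 0; E_{ab} 0)`. [cite: Humphreys1972, §1.2] -/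
theorem single_inr_inl (a b : l) (c : R) :
    (single (inr a) (inl b) c : Matrix (l ⊕ l) (l ⊕ l) R) = fromBlocks 0 0 (single a b c) (0 : Matrix l l R) := by
  ext p q
  rcases p with p | p <;> rcases q with q | q <;> simp [single_apply]

omit [Fintype l] in
/-- `E_{a'b'}` is the block matrix `(0 0; 0 E_{ab})`. [cite: Humphreys1972, §1.2] -/
theorem single_inr_inr (a b : l) (c : R) :
    (single (inr a) (inr b) c : Matrix (l ⊕ l) (l ⊕ l) R) = fromBlocks (0 : Matrix l l R) 0 0 (single a b c) := by
  ext p q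
  rcases p with p | p <;> rcases q with q | q <;> simp [single_apply]

/-- The basis vector `n(E_{aa}) = E_{aa'}` lies in `𝔰𝔭(2l, R)`. [cite: Humphreys1972, §1.2 (type `C_l` basis)] -/
theorem single_inl_inr_mem_sp (a : l) : single (inl a) (inr a) (1 : R) ∈ sp l R := by
  rw [single_inl_inr, fromBlocks_mem_sp_iff]
  exact ⟨by simp, transpose_single a a 1, transpose_zero⟩

/-- The basis vector `p(E_{aa}) = E_{a'a}` lies in `𝔰𝔭(2l, R)`. [cite: Humphreys1972, §1.2 (type `C_l` basis)] -/
theorem single_inr_inl_mem_sp (a : l) : single (inr a) (inl a) (1 : R) ∈ sp l R := by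
  rw [single_inr_inl, fromBlocks_mem_sp_iff]
  exact ⟨by simp, transpose_zero, transpose_single a a 1⟩

/-- The basis vector `m(E_{ab}) = E_{ab} − E_{b'a'}` lies in `𝔰𝔭(2l, R)` (for `a = b` this is the diagonal
`h_a = E_{aa} − E_{a'a'}`). [cite: Humphreys1972, §1.2 (type `C_l` basis)] -/
theorem single_inl_inl_sub_single_inr_inr_mem_sp (a b : l) :
    single (inl a) (inl b) (1 : R) - single (inr b) (inr a) 1 ∈ sp l R := by
  rw [single_inl_inl, single_inr_inr, sub_eq_add_neg, fromBlocks_neg, fromBlocks_add, fromBlocks_mem_sp_iff]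
  refine ⟨?_, by simp, by simp⟩
  rw [transpose_add, transpose_single, neg_zero, transpose_zero, add_zero, zero_add]

/-- The vector `n(E_{ab} + E_{ba}) = E_{ab'} + E_{ba'}` lies in `𝔰𝔭(2l, R)`. [cite: Humphreys1972, §1.2 (type `C_l` basis)] -/
theorem single_inl_inr_add_mem_sp (a b : l) :
    single (inl a) (inr b) (1 : R) + single (inl b) (inr a) 1 ∈ sp l R := by
  rw [single_inl_inr, single_inl_inr, fromBlocks_add, fromBlocks_mem_sp_iff]
  refine ⟨by simp, ?_, by simp⟩
  rw [transpose_add, transpose_single, transpose_single, add_comm]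

/-- The vector `p(E_{ab} + E_{ba}) = E_{a'b} + E_{b'a}` lies in `𝔰𝔭(2l, R)`. [cite: Humphreys1972, §1.2 (type `C_l` basis)] -/
theorem single_inr_inl_add_mem_sp (a b : l) :
    single (inr a) (inl b) (1 : R) + single (inr b) (inl a) 1 ∈ sp l R := by
  rw [single_inr_inl, single_inr_inl, fromBlocks_add, fromBlocks_mem_sp_iff]
  refine ⟨by simp, by simp, ?_⟩
  rw [transpose_add, transpose_single, transpose_single, add_comm]

/-! ### Commutator identities among the basis vectors [Humphreys1972, §2 Exercise 6, §19.2] -/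

/-- `E_{jj'}(E_{ii'}X − XE_{ii'}) − (E_{ii'}X − XE_{ii'})E_{jj'} = −X_{j'i}E_{ji'} − X_{i'j}E_{ij'}`: a double bracket
with `n`-type basis vectors isolates the lower-left block. [cite: Humphreys1972, §2 Exercise 6, §19.2] -/
theorem nn_comm (i j : l) (X : Matrix (l ⊕ l) (l ⊕ l) R) :
    single (inl j) (inr j) (1 : R) * (single (inl i) (inr i) (1 : R) * X - X * single (inl i) (inr i) 1)
        - (single (inl i) (inr i) (1 : R) * X - X * single (inl i) (inr i) 1) * single (inl j) (inr j) 1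
      = -single (inl j) (inr i) (X (inr j) (inl i)) - single (inl i) (inr j) (X (inr i) (inl j)) := by
  have h1 : single (inl j) (inr j) (1 : R) * (single (inl i) (inr i) (1 : R) * X) = 0 := by
    rw [← Matrix.mul_assoc, E_mul_E_of_ne inr_ne_inl, Matrix.zero_mul]
  have h2 : single (inl j) (inr j) (1 : R) * (X * single (inl i) (inr i) 1) =
      single (inl j) (inr i) (X (inr j) (inl i)) := by
    rw [← Matrix.mul_assoc, E_mul_mul_E]
  have h4 : X * single (inl i) (inr i) (1 : R) * single (inl j) (inr j) 1 = 0 := by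
    rw [Matrix.mul_assoc, E_mul_E_of_ne inr_ne_inl, Matrix.mul_zero]
  rw [Matrix.mul_sub, Matrix.sub_mul, h1, h2, E_mul_mul_E, h4]
  abel

/-- `[m(E_{ji}), E_{ij'} + E_{ji'}] = 2E_{jj'}` for `i ≠ j`. [cite: Humphreys1972, §2 Exercise 6, §19.2] -/
theorem m_comm_nsum {i j : l} (hij : i ≠ j) :
    (single (inl j) (inl i) (1 : R) - single (inr i) (inr j) 1) * (single (inl i) (inr j) (1 : R) + single (inl j) (inr i) 1)
        - (single (inl i) (inr j) (1 : R) + single (inl j) (inr i) 1)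
          * (single (inl j) (inl i) (1 : R) - single (inr i) (inr j) 1)
      = (2 : R) • single (inl j) (inr j) (1 : R) := by
  have hij' : (inl i : l ⊕ l) ≠ inl j := fun h => hij (inl_injective h)
  have hji' : (inr j : l ⊕ l) ≠ inr i := fun h => hij (inr_injective h).symm
  simp only [Matrix.sub_mul, Matrix.mul_sub, Matrix.add_mul, Matrix.mul_add, E_mul_E, E_mul_E_of_ne hij',
    E_mul_E_of_ne hji', E_inr_mul_E_inl, two_smul]
  abel

/-- `[E_{k'k}, E_{kk'}] = E_{k'k'} − E_{kk} = −h_k`. [cite: Humphreys1972, §2 Exercise 6, §19.2] -/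
theorem vn_comm (k : l) :
    single (inr k) (inl k) (1 : R) * single (inl k) (inr k) 1 - single (inl k) (inr k) 1 * single (inr k) (inl k) 1
      = single (inr k) (inr k) 1 - single (inl k) (inl k) 1 := by
  rw [E_mul_E, E_mul_E]

/-- `[E_{k'k}, h_k] = 2E_{k'k}`. [cite: Humphreys1972, §2 Exercise 6, §19.2] -/
theorem v_comm_h (k : l) :
    single (inr k) (inl k) (1 : R) * (single (inl k) (inl k) (1 : R) - single (inr k) (inr k) 1)
        - (single (inl k) (inl k) (1 : R) - single (inr k) (inr k) 1) * single (inr k) (inl k) 1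
      = (2 : R) • single (inr k) (inl k) (1 : R) := by
  rw [Matrix.mul_sub, Matrix.sub_mul, E_mul_E, E_mul_E_of_ne inl_ne_inr, E_mul_E_of_ne inl_ne_inr, E_mul_E, two_smul]
  abel

/-- `[m(E_{jk}), E_{kk'}] = E_{jk'} + E_{kj'}`. [cite: Humphreys1972, §2 Exercise 6, §19.2] -/
theorem m_comm_n (j k : l) :
    (single (inl j) (inl k) (1 : R) - single (inr k) (inr j) 1) * single (inl k) (inr k) 1
        - single (inl k) (inr k) 1 * (single (inl j) (inl k) (1 : R) - single (inr k) (inr j) 1)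
      = single (inl j) (inr k) 1 + single (inl k) (inr j) 1 := by
  rw [Matrix.sub_mul, Matrix.mul_sub, E_mul_E, E_mul_E_of_ne inr_ne_inl, E_mul_E_of_ne inr_ne_inl, E_mul_E]
  abel

/-- `[m(E_{kj}), E_{k'k}] = −(E_{k'j} + E_{j'k})`. [cite: Humphreys1972, §2 Exercise 6, §19.2] -/
theorem m_comm_v (j k : l) :
    (single (inl k) (inl j) (1 : R) - single (inr j) (inr k) 1) * single (inr k) (inl k) 1
        - single (inr k) (inl k) 1 * (single (inl k) (inl j) (1 : R) - single (inr j) (inr k) 1)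
      = -(single (inr k) (inl j) 1 + single (inr j) (inl k) 1) := by
  rw [Matrix.sub_mul, Matrix.mul_sub, E_mul_E_of_ne inl_ne_inr, E_mul_E, E_mul_E, E_mul_E_of_ne inl_ne_inr]
  abel

/-- `[E_{jj'}, E_{j'k} + E_{k'j}] = E_{jk} − E_{k'j'} = m(E_{jk})` for `j ≠ k`. [cite: Humphreys1972, §2 Exercise 6, §19.2] -/
theorem n_comm_vsum {j k : l} (hjk : j ≠ k) :
    single (inl j) (inr j) (1 : R) * (single (inr j) (inl k) (1 : R) + single (inr k) (inl j) 1)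
        - (single (inr j) (inl k) (1 : R) + single (inr k) (inl j) 1) * single (inl j) (inr j) 1
      = single (inl j) (inl k) 1 - single (inr k) (inr j) 1 := by
  have hjk' : (inr j : l ⊕ l) ≠ inr k := fun h => hjk (inr_injective h)
  have hkj' : (inl k : l ⊕ l) ≠ inl j := fun h => hjk (inl_injective h).symm
  rw [Matrix.mul_add, Matrix.add_mul, E_mul_E, E_mul_E_of_ne hjk', E_mul_E_of_ne hkj', E_mul_E]
  abel

/-- The `(j', k)` entry of `[E_{j'j}, X]` for `k ≠ j` is `X_{jk}`. [cite: Humphreys1972, §19.2] -/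
theorem v_comm_apply_inr_inl_of_ne (X : Matrix (l ⊕ l) (l ⊕ l) R) {j k : l} (hkj : k ≠ j) :
    (single (inr j) (inl j) (1 : R) * X - X * single (inr j) (inl j) 1 : Matrix (l ⊕ l) (l ⊕ l) R) (inr j) (inl k)
      = X (inl j) (inl k) := by
  rw [Matrix.sub_apply, single_mul_apply_same, one_mul,
    mul_single_apply_of_ne (hbj := fun e => hkj (inl_injective e)), sub_zero]

/-- The `(j', j)` entry of `[E_{j'j}, X]` is `X_{jj} − X_{j'j'}`. [cite: Humphreys1972, §19.2] -/
theorem v_comm_apply_inr_inl_self (X : Matrix (l ⊕ l) (l ⊕ l) R) (j : l) :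
    (single (inr j) (inl j) (1 : R) * X - X * single (inr j) (inl j) 1 : Matrix (l ⊕ l) (l ⊕ l) R) (inr j) (inl j)
      = X (inl j) (inl j) - X (inr j) (inr j) := by
  rw [Matrix.sub_apply, single_mul_apply_same, one_mul, mul_single_apply_same, mul_one]

/-- The `(a, k)` entry of `[E_{k'k}, X]` is `−X_{ak'}`. [cite: Humphreys1972, §19.2] -/
theorem v_comm_apply_inl_inl (X : Matrix (l ⊕ l) (l ⊕ l) R) (a k : l) :
    (single (inr k) (inl k) (1 : R) * X - X * single (inr k) (inl k) 1 : Matrix (l ⊕ l) (l ⊕ l) R) (inl a) (inl k)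
      = -X (inl a) (inr k) := by
  rw [Matrix.sub_apply, single_mul_apply_of_ne (h := inl_ne_inr), mul_single_apply_same, mul_one, zero_sub]

/-- `n + nᵀ = Σ_{a,b} n_{ab}(E_{ab} + E_{ba})`. [cite: Humphreys1972, §1.2] -/
theorem add_transpose_eq_sum_smul (B : Matrix l l R) :
    B + Bᵀ = ∑ a, ∑ b, B a b • (single a b (1 : R) + single b a 1) := by
  have hB : B = ∑ a, ∑ b, B a b • single a b (1 : R) := by
    simpa only [smul_single, smul_eq_mul, mul_one] using matrix_eq_sum_single B
  have hT : Bᵀ = ∑ a, ∑ b, B a b • single b a (1 : R) := by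
    have h := matrix_eq_sum_single Bᵀ
    rw [Finset.sum_comm] at h
    simpa only [smul_single, smul_eq_mul, mul_one, transpose_apply] using h
  simp only [smul_add, Finset.sum_add_distrib]
  rw [← hB, ← hT]

/-! ### Simplicity -/

section ideal

variable {P : Submodule K (Matrix (l ⊕ l) (l ⊕ l) K)}

/-- Step 1(a): if `P` is stable under `ad 𝔰𝔭` and contains `X ∈ 𝔰𝔭` with a non-zero lower-left entry `X_{i'j}`,
then some `E_{kk'} ∈ P`. [cite: Humphreys1972, §2 Exercise 6, §19.2] -/
theorem exists_single_inl_inr_mem_of_apply_inr_inl_ne_zero (h2 : (2 : K) ≠ 0)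
    (hP : ∀ ⦃Y m : Matrix (l ⊕ l) (l ⊕ l) K⦄, Y ∈ sp l K → m ∈ P → Y * m - m * Y ∈ P)
    {X : Matrix (l ⊕ l) (l ⊕ l) K} (hXsp : X ∈ sp l K) (hXP : X ∈ P) {i j : l}
    (hne : X (inr i) (inl j) ≠ 0) : ∃ k : l, single (inl k) (inr k) (1 : K) ∈ P := by
  have hPsmul : ∀ {c : K} {m : Matrix (l ⊕ l) (l ⊕ l) K}, c ≠ 0 → c • m ∈ P → m ∈ P :=
    fun hc hm => (P.smul_mem_iff hc).1 hm
  have h1 := hP (single_inl_inr_mem_sp j) (hP (single_inl_inr_mem_sp i) hXP)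
  rw [nn_comm i j X, apply_inr_inl_of_mem_sp hXsp j i] at h1
  have hsum : single (inl i) (inr j) (1 : K) + single (inl j) (inr i) 1 ∈ P := by
    have e : (-single (inl j) (inr i) (X (inr i) (inl j)) - single (inl i) (inr j) (X (inr i) (inl j)) :
          Matrix (l ⊕ l) (l ⊕ l) K)
        = (-X (inr i) (inl j)) • (single (inl i) (inr j) (1 : K) + single (inl j) (inr i) 1) := by
      rw [single_eq_smul_E (inl j) (inr i) (X (inr i) (inl j)), single_eq_smul_E (inl i) (inr j) (X (inr i) (inl j)),
        smul_add, neg_smul, neg_smul]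
      abel
    rw [e] at h1
    exact hPsmul (neg_ne_zero.2 hne) h1
  by_cases hij : i = j
  · subst hij
    refine ⟨i, hPsmul h2 ?_⟩
    rwa [two_smul]
  · refine ⟨j, hPsmul h2 ?_⟩
    have h3 := hP (single_inl_inl_sub_single_inr_inr_mem_sp j i) hsum
    rwa [m_comm_nsum hij] at h3

/-- Step 1: if `P` is stable under `ad 𝔰𝔭` and contains a non-zero `X ∈ 𝔰𝔭`, then some `E_{kk'} ∈ P`.
[cite: Humphreys1972, §2 Exercise 6, §19.2] -/
theorem exists_single_inl_inr_mem_of_ne_zero (h2 : (2 : K) ≠ 0)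
    (hP : ∀ ⦃Y m : Matrix (l ⊕ l) (l ⊕ l) K⦄, Y ∈ sp l K → m ∈ P → Y * m - m * Y ∈ P)
    (hPsp : ∀ ⦃m : Matrix (l ⊕ l) (l ⊕ l) K⦄, m ∈ P → m ∈ sp l K)
    {X : Matrix (l ⊕ l) (l ⊕ l) K} (hXP : X ∈ P) (hX0 : X ≠ 0) : ∃ k : l, single (inl k) (inr k) (1 : K) ∈ P := by
  have hXsp := hPsp hXP
  -- (b) a non-zero entry in the upper-left block is moved to the lower-left block by `[E_{j'j}, ·]`
  have caseA : ∀ {Y : Matrix (l ⊕ l) (l ⊕ l) K}, Y ∈ P → ∀ j k : l, Y (inl j) (inl k) ≠ 0 →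
      ∃ k : l, single (inl k) (inr k) (1 : K) ∈ P := by
    intro Y hYP j k hne
    have hYsp := hPsp hYP
    have hZ := hP (single_inr_inl_mem_sp j) hYP
    by_cases hkj : k = j
    · rw [hkj] at hne
      refine exists_single_inl_inr_mem_of_apply_inr_inl_ne_zero h2 hP (hPsp hZ) hZ (i := j) (j := j) ?_
      rw [v_comm_apply_inr_inl_self, apply_inr_inr_of_mem_sp hYsp, sub_neg_eq_add, ← two_mul]
      exact mul_ne_zero h2 hne
    · refine exists_single_inl_inr_mem_of_apply_inr_inl_ne_zero h2 hP (hPsp hZ) hZ (i := j) (j := k) ?_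
      rwa [v_comm_apply_inr_inl_of_ne Y hkj]
  by_cases hC : ∃ i j : l, X (inr i) (inl j) ≠ 0
  · obtain ⟨i, j, hne⟩ := hC
    exact exists_single_inl_inr_mem_of_apply_inr_inl_ne_zero h2 hP hXsp hXP hne
  by_cases hA : ∃ j k : l, X (inl j) (inl k) ≠ 0
  · obtain ⟨j, k, hne⟩ := hA
    exact caseA hXP j k hne
  by_cases hB : ∃ j k : l, X (inl j) (inr k) ≠ 0
  · -- (c) a non-zero entry in the upper-right block is moved to the upper-left block by `[E_{k'k}, ·]`
    obtain ⟨j, k, hne⟩ := hB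
    refine caseA (hP (single_inr_inl_mem_sp k) hXP) j k ?_
    rw [v_comm_apply_inl_inl]
    exact neg_ne_zero.2 hne
  push Not at hC hA hB
  exfalso
  apply hX0
  ext p q
  rcases p with a | a <;> rcases q with b | b
  · exact hA a b
  · exact hB a b
  · exact hC a b
  · simp [apply_inr_inr_of_mem_sp hXsp, hA]

/-- Step 2–3: if `P` is stable under `ad 𝔰𝔭`, `2 ≠ 0`, and some `E_{kk'} ∈ P`, then `𝔰𝔭(2l, K) ⊆ P`.
[cite: Humphreys1972, §1.2, §2 Exercise 6, §19.2] -/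
theorem mem_of_single_inl_inr_mem (h2 : (2 : K) ≠ 0)
    (hP : ∀ ⦃Y m : Matrix (l ⊕ l) (l ⊕ l) K⦄, Y ∈ sp l K → m ∈ P → Y * m - m * Y ∈ P)
    {k : l} (hk : single (inl k) (inr k) (1 : K) ∈ P) {X : Matrix (l ⊕ l) (l ⊕ l) K} (hX : X ∈ sp l K) :
    X ∈ P := by
  have hPsmul : ∀ {c : K} {m : Matrix (l ⊕ l) (l ⊕ l) K}, c ≠ 0 → c • m ∈ P → m ∈ P :=
    fun hc hm => (P.smul_mem_iff hc).1 hm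
  -- Step 2: all the basis vectors lie in `P`
  have hn : ∀ j : l, single (inl j) (inr j) (1 : K) ∈ P := by
    intro j
    by_cases hjk : j = k
    · rw [hjk]; exact hk
    · have hU := hP (single_inl_inl_sub_single_inr_inr_mem_sp j k) hk
      rw [m_comm_n, add_comm] at hU
      have h := hP (single_inl_inl_sub_single_inr_inr_mem_sp j k) hU
      rw [m_comm_nsum (Ne.symm hjk)] at h
      exact hPsmul h2 h
  have hh : ∀ j : l, single (inl j) (inl j) (1 : K) - single (inr j) (inr j) 1 ∈ P := by
    intro j
    have h := hP (single_inr_inl_mem_sp j) (hn j)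
    rw [vn_comm, ← neg_sub] at h
    exact P.neg_mem_iff.1 h
  have hv : ∀ j : l, single (inr j) (inl j) (1 : K) ∈ P := by
    intro j
    have h := hP (single_inr_inl_mem_sp j) (hh j)
    rw [v_comm_h] at h
    exact hPsmul h2 h
  have hN : ∀ a b : l, single (inl a) (inr b) (1 : K) + single (inl b) (inr a) 1 ∈ P := by
    intro a b
    have h := hP (single_inl_inl_sub_single_inr_inr_mem_sp a b) (hn b)
    rwa [m_comm_n] at h
  have hV : ∀ a b : l, single (inr a) (inl b) (1 : K) + single (inr b) (inl a) 1 ∈ P := by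
    intro a b
    have h := hP (single_inl_inl_sub_single_inr_inr_mem_sp a b) (hv a)
    rw [m_comm_v] at h
    exact P.neg_mem_iff.1 h
  have hM : ∀ a b : l, single (inl a) (inl b) (1 : K) - single (inr b) (inr a) 1 ∈ P := by
    intro a b
    by_cases hab : a = b
    · subst hab; exact hh a
    · have h := hP (single_inl_inr_mem_sp a) (hV a b)
      rwa [n_comm_vsum hab] at h
  -- Step 3: the basis vectors span `𝔰𝔭(2l, K)`; write `X = (A B; C −Aᵀ)` with `B`, `C` symmetric
  rw [← fromBlocks_toBlocks X] at hX ⊢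
  obtain ⟨hD, hB, hC⟩ := (fromBlocks_mem_sp_iff _ _ _ _).1 hX
  rw [hD]
  have e : fromBlocks X.toBlocks₁₁ X.toBlocks₁₂ X.toBlocks₂₁ (-X.toBlocks₁₁ᵀ) =
      fromBlocks X.toBlocks₁₁ 0 0 (-X.toBlocks₁₁ᵀ) + fromBlocks 0 X.toBlocks₁₂ 0 0 + fromBlocks 0 0 X.toBlocks₂₁ 0 := by
    rw [fromBlocks_add, fromBlocks_add]
    simp
  rw [e]
  refine add_mem (add_mem ?_ ?_) ?_
  · -- the block `m`: `(A 0; 0 −Aᵀ) = Σ A_{ab} m(E_{ab})`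
    let L : Matrix l l K →ₗ[K] Matrix (l ⊕ l) (l ⊕ l) K :=
      { toFun := fun x => fromBlocks x 0 0 (-xᵀ)
        map_add' := fun x y => by rw [fromBlocks_add, add_zero, transpose_add, neg_add]
        map_smul' := fun c x => by rw [RingHom.id_apply, fromBlocks_smul, smul_zero, transpose_smul, smul_neg] }
    have hL : ∀ (a b : l) (c : K), L (single a b c) ∈ P := by
      intro a b c
      rw [single_eq_smul_E, map_smul]
      refine P.smul_mem _ ?_
      change fromBlocks (single a b (1 : K)) 0 0 (-(single a b (1 : K))ᵀ) ∈ P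
      have e' : fromBlocks (single a b (1 : K)) 0 0 (-(single a b (1 : K))ᵀ) =
          single (inl a) (inl b) (1 : K) - single (inr b) (inr a) 1 := by
        rw [transpose_single, single_inl_inl, single_inr_inr, sub_eq_add_neg, fromBlocks_neg, fromBlocks_add]
        simp
      rw [e']
      exact hM a b
    change L X.toBlocks₁₁ ∈ P
    rw [matrix_eq_sum_single X.toBlocks₁₁, map_sum]
    refine P.sum_mem fun a _ => ?_
    rw [map_sum]
    exact P.sum_mem fun b _ => hL a b _
  · -- the block `n`: `2(0 B; 0 0) = (0 B+Bᵀ; 0 0) = Σ B_{ab} n(E_{ab} + E_{ba})`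
    let L : Matrix l l K →ₗ[K] Matrix (l ⊕ l) (l ⊕ l) K :=
      { toFun := fun x => fromBlocks 0 x 0 0
        map_add' := fun x y => by rw [fromBlocks_add, add_zero]
        map_smul' := fun c x => by rw [RingHom.id_apply, fromBlocks_smul, smul_zero] }
    have hL : ∀ a b : l, L (single a b (1 : K) + single b a 1) ∈ P := by
      intro a b
      change fromBlocks 0 (single a b (1 : K) + single b a 1) 0 0 ∈ P
      have e' : fromBlocks (0 : Matrix l l K) (single a b (1 : K) + single b a 1) 0 (0 : Matrix l l K) =
          single (inl a) (inr b) (1 : K) + single (inl b) (inr a) 1 := by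
        rw [single_inl_inr, single_inl_inr, fromBlocks_add]
        simp
      rw [e']
      exact hN a b
    refine hPsmul h2 ?_
    have e2 : (2 : K) • fromBlocks (0 : Matrix l l K) X.toBlocks₁₂ 0 0 = L (X.toBlocks₁₂ + X.toBlocks₁₂ᵀ) := by
      rw [hB, ← two_smul K X.toBlocks₁₂, map_smul]
      rfl
    rw [e2, add_transpose_eq_sum_smul, map_sum]
    refine P.sum_mem fun a _ => ?_
    rw [map_sum]
    refine P.sum_mem fun b _ => ?_
    rw [map_smul]
    exact P.smul_mem _ (hL a b)
  · -- the block `p`: `2(0 0; C 0) = (0 0; C+Cᵀ 0) = Σ C_{ab} p(E_{ab} + E_{ba})`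
    let L : Matrix l l K →ₗ[K] Matrix (l ⊕ l) (l ⊕ l) K :=
      { toFun := fun x => fromBlocks 0 0 x 0
        map_add' := fun x y => by rw [fromBlocks_add, add_zero]
        map_smul' := fun c x => by rw [RingHom.id_apply, fromBlocks_smul, smul_zero] }
    have hL : ∀ a b : l, L (single a b (1 : K) + single b a 1) ∈ P := by
      intro a b
      change fromBlocks 0 0 (single a b (1 : K) + single b a 1) 0 ∈ P
      have e' : fromBlocks (0 : Matrix l l K) 0 (single a b (1 : K) + single b a 1) (0 : Matrix l l K) =
          single (inr a) (inl b) (1 : K) + single (inr b) (inl a) 1 := by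
        rw [single_inr_inl, single_inr_inl, fromBlocks_add]
        simp
      rw [e']
      exact hV a b
    refine hPsmul h2 ?_
    have e2 : (2 : K) • fromBlocks (0 : Matrix l l K) 0 X.toBlocks₂₁ 0 = L (X.toBlocks₂₁ + X.toBlocks₂₁ᵀ) := by
      rw [hC, ← two_smul K X.toBlocks₂₁, map_smul]
      rfl
    rw [e2, add_transpose_eq_sum_smul, map_sum]
    refine P.sum_mem fun a _ => ?_
    rw [map_sum]
    refine P.sum_mem fun b _ => ?_
    rw [map_smul]
    exact P.smul_mem _ (hL a b)

end ideal

/-- **Every Lie ideal of `𝔰𝔭(2l, K)` is `⊥` or `⊤`** when `2 ≠ 0` in `K`.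
[cite: Humphreys1972, §2 Exercise 6, §19.2 (type `C_l`)] [cite: Hall2015, Cor. 8.47] -/
theorem eq_bot_or_eq_top_of_lieIdeal (h2 : (2 : K) ≠ 0) (I : LieIdeal K (sp l K)) : I = ⊥ ∨ I = ⊤ := by
  classical
  letI : LieRing (Matrix (l ⊕ l) (l ⊕ l) K) := LieRing.ofAssociativeRing
  letI : LieAlgebra K (Matrix (l ⊕ l) (l ⊕ l) K) := LieAlgebra.ofAssociativeAlgebra
  -- the image `P` of `I` in the matrices, a `K`-submodule stable under `Y·m − m·Y` for `Y ∈ 𝔰𝔭`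
  set P : Submodule K (Matrix (l ⊕ l) (l ⊕ l) K) := (I : Submodule K (sp l K)).map (sp l K).toSubmodule.subtype
    with hPdef
  have hPmem : ∀ {m : Matrix (l ⊕ l) (l ⊕ l) K}, m ∈ P ↔ ∃ hm : m ∈ sp l K, (⟨m, hm⟩ : sp l K) ∈ I := by
    intro m
    rw [hPdef, Submodule.mem_map]
    constructor
    · rintro ⟨y, hy, rfl⟩
      exact ⟨y.2, hy⟩
    · rintro ⟨hm, hmI⟩
      exact ⟨⟨m, hm⟩, hmI, rfl⟩
  have hP : ∀ ⦃Y m : Matrix (l ⊕ l) (l ⊕ l) K⦄, Y ∈ sp l K → m ∈ P → Y * m - m * Y ∈ P := by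
    intro Y m hY hm
    obtain ⟨hm, hmI⟩ := hPmem.1 hm
    have h := I.lie_mem (x := (⟨Y, hY⟩ : sp l K)) hmI
    exact hPmem.2 ⟨_, h⟩
  have hPsp : ∀ ⦃m : Matrix (l ⊕ l) (l ⊕ l) K⦄, m ∈ P → m ∈ sp l K := fun m hm => (hPmem.1 hm).1
  by_cases hbot : ∀ m ∈ I, m = (0 : sp l K)
  · left
    rw [eq_bot_iff]
    intro m hm
    rw [LieSubmodule.mem_bot]
    exact hbot m hm
  right
  push Not at hbot
  obtain ⟨x, hxI, hx0⟩ := hbot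
  have hXP : (x : Matrix (l ⊕ l) (l ⊕ l) K) ∈ P := hPmem.2 ⟨x.2, hxI⟩
  have hX0 : (x : Matrix (l ⊕ l) (l ⊕ l) K) ≠ 0 := fun h => hx0 (Subtype.ext h)
  obtain ⟨k, hk⟩ := exists_single_inl_inr_mem_of_ne_zero h2 hP hPsp hXP hX0
  rw [eq_top_iff]
  rintro y -
  obtain ⟨hy, hyI⟩ := hPmem.1 (mem_of_single_inl_inr_mem h2 hP hk y.2)
  exact hyI

variable (l K) in
/-- `[E_{kk'}, E_{k'k}] = h_k ≠ 0`: **`𝔰𝔭(2l, K)` is not abelian** (`l` non-empty). [cite: Humphreys1972, §1.2, §19.2] -/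
theorem sp_non_abelian [Nonempty l] : ¬IsLieAbelian (sp l K) := by
  letI : LieRing (Matrix (l ⊕ l) (l ⊕ l) K) := LieRing.ofAssociativeRing
  letI : LieAlgebra K (Matrix (l ⊕ l) (l ⊕ l) K) := LieAlgebra.ofAssociativeAlgebra
  obtain ⟨k⟩ := ‹Nonempty l›
  intro h
  have hc := h.trivial ⟨_, single_inl_inr_mem_sp (R := K) k⟩ ⟨_, single_inr_inl_mem_sp (R := K) k⟩
  have hc' := congrArg Subtype.val hc
  rw [LieSubalgebra.coe_bracket, ZeroMemClass.coe_zero, Ring.lie_def, E_mul_E, E_mul_E] at hc'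
  have h11 := congrFun (congrFun hc' (inl k)) (inl k)
  simp at h11

variable (l K) in
/-- **`𝔰𝔭(2l, K)` IS SIMPLE** (Mathlib `LieAlgebra.IsSimple`) for `l` non-empty, whenever `2 ≠ 0` in `K`: the
simple Lie algebra of type `C_l` (`C_1 = A_1`). [cite: Humphreys1972, §19.2 (the classical algebras are simple)]
[cite: Hall2015, Cor. 8.47 (`𝔰𝔭(n; ℂ)`, `n ≥ 1`, is simple)] -/
theorem isSimple_sp [Nonempty l] (h2 : (2 : K) ≠ 0) : LieAlgebra.IsSimple K (sp l K) :=
  ⟨eq_bot_or_eq_top_of_lieIdeal h2, sp_non_abelian l K⟩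

variable (l K) in
/-- **`𝔰𝔭(2l, K)` is simple in characteristic zero** (`l` non-empty), e.g. `𝔰𝔭(2l, ℚ)`, `𝔰𝔭(2l, ℝ)`, `𝔰𝔭(2l, ℂ)`.
[cite: Humphreys1972, §19.2] [cite: Hall2015, Cor. 8.47] -/
theorem isSimple_sp_of_charZero [Nonempty l] [CharZero K] : LieAlgebra.IsSimple K (sp l K) :=
  isSimple_sp l K two_ne_zero

/-- A simple consequence used for Hodge groups: a proper Lie ideal of `𝔰𝔭(2l, K)` is `⊥` (`2 ≠ 0`).
[cite: Humphreys1972, §19.2] -/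
theorem lieIdeal_eq_bot_of_ne_top (h2 : (2 : K) ≠ 0) {I : LieIdeal K (sp l K)} (hI : I ≠ ⊤) : I = ⊥ :=
  (eq_bot_or_eq_top_of_lieIdeal h2 I).resolve_right hI

/-- … and a non-zero Lie ideal of `𝔰𝔭(2l, K)` is `⊤` (`2 ≠ 0`). [cite: Humphreys1972, §19.2] -/
theorem lieIdeal_eq_top_of_ne_bot (h2 : (2 : K) ≠ 0) {I : LieIdeal K (sp l K)} (hI : I ≠ ⊥) : I = ⊤ :=
  (eq_bot_or_eq_top_of_lieIdeal h2 I).resolve_left hI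

end Literature.Algebra.Lie.SymplecticSimple
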